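import Summits.NavierStokesRegularity.NavierStokesRegularity.Theorems.ScenarioCensusRowF1ThinTopRows
import Summits.NavierStokesRegularity.NavierStokesRegularity.Theorems.ScenarioCensusRowF1SocketTop
import Summits.NavierStokesRegularity.NavierStokesRegularity.Theorems.ScenarioCensusRowF1SharpTopDom
import HarnessLib

/-!
# LINE 29 «thin-top» port, part 3/3: §8 LINE 27's `Row_F1vol` IS THE `r = 1` MEMBER (`rowF1vol_of_rowF1ps`, Tonelli; `Row_F1vol` itself BY NAME), `volumeAxis_chain`; §9 THE
# WEAK-`L³` READING (`weakCubeAbove`, `Row_F1wk` / `rowF1wk_holds`, floor `PersistentWeakCube`); census KEYS `Row_F1th` / `Row_F1vo` / `Row_F1ps` / `Row_F1wk` + `_excluded`,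
# floors, edges

Re-homed for the scenario census (typer seat ns-census-typer-1 g9; the cells F1th / F1vo / F1ps (+ F1wk) and the floors are MEMBERS OF RECORD «DECIDED IN KERNEL IN FILES»
of row F1 since census v1.92 (critic idea-crit-3 g8 PASS 06:25:46Z — no price; ref ns-census-ref g11 PRE-CHECK ✓ §16.23 item 56; lead-presearch label); this port
makes them TREE-decided): VERBATIM PORT of the NEW sections (§6–§9) of ns-idea-3 LINE 29 «thin-top», `pub/ideators/ns-idea-3/lines/thin-top/line-thin-top.lean` sha16
4cd0e2efd2dcc4d5 (1617 l., lean check rc 0, 0 sorry; its §1–§5 = LINE 27/28 VERBATIM, taken BY NAME from `ScenarioCensusRowF1Socket*` / `…SharpTop*`), split for the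
400-line rule into `ScenarioCensusRowF1ThinTop` (§6) → `…ThinTopRows` (§7) → `…ThinTopVolume` (§8–§9 + census KEYS).  Lean text VERBATIM in namespace
`…Theorems.ScenarioCensus.ThinTop` (the line's `…Cruxes.ScenarioCensusRowF1.ThinTopLine` re-homed) with `open …LiouvilleSocket …SharpTop`; port edits: the bracket lines
`section …` / `end …` dropped (no `variable`s), §8's VERBATIM restatement of LINE 27's `volIntegrand` / `Row_F1vol` / `volIntegrand_mono` / `rowF1vol_holds` not
re-declared (BY NAME), `@[conjecture]` on the residual `ThinSlack` (≡ `ScenarioCensus.Row_F1`, OPEN), one-line docstrings added where missing (gate lint).  Statements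
untouched.

No census VALUE is moved here (row F1 stays OPEN-WITH-LINE; the members become TREE-decided by name); NS regularity is NOT proved; `Row_F1` is untouched (zero
movement, `thinSlack_iff_rowF1`); no summit statement is proved by this file. Lemmas that restate already-landed tree declarations are taken BY NAME (gate lint `dedup.landed`): `fderiv_smul_stPull_apply` = `InviscidTop.fderiv_smul_stPull_apply`, `fderiv_smul_stPull` = `InviscidTop.fderiv_smul_stPull`, `fderiv_fderiv_smul_stPull` = `InviscidTop.fderiv_fderiv_smul_stPull`, `tendsto_clm_of_tendsto_apply` = `InviscidTop.tendsto_clm_of_tendsto_apply`, `tendsto_fderiv_fderiv_apply_of_bound` = `InviscidTop.tendsto_fderiv_fderiv_apply_of_bound`, `tendsto_fderiv_fderiv_of_bound` = `InviscidTop.tendsto_fderiv_fderiv_of_bound`, `tendsto_fderiv_fderiv_of_typeI_seq_Ioo` = `InviscidTop.tendsto_fderiv_fderiv_of_typeI_seq_Ioo`, `fderiv3_smul_stPull` = `FrozenTop.fderiv3_smul_stPull`, `tendsto_fderiv3_of_typeI_seq_Ioo` = `FrozenTop.tendsto_fderiv3_of_typeI_seq_Ioo`, `tendsto_physicalTime`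 = `ColumnarTop.tendsto_physicalTime`, `eventually_fast` = `ColumnarTop.eventually_fast`, `sqrt_timeLag` = `StretchedTop.sqrt_timeLag`, `forall_of_forall_ne_zero` = `StretchedTop.forall_of_forall_ne_zero`, `radius_eq` = `FrozenTop.radius_eq`, `jointCond_everywhere₆` = `FrozenTop.jointCond_everywhere₄`, `continuousOn_quad` = `IntegratedStretch.continuousOn_quad`, `sqrt_nu_timeLag` = `IntegratedStretch.sqrt_nu_timeLag`, `sing_of_not_bounded` = `InviscidTop.sing_of_not_bounded`, `exists_singularZoom_package₃` = `FrozenTop.exists_singularZoom_package₃`, `lapD_eq_zero_of_eq_zero` = `FrozenTop.lapD_eq_zero_of_eq_zero`, `measurableSet_top` = `IntegratedStretch.measurableSet_top`, `cross_smul_smul` = `UnthreadedRigidity.ThreadingJets.cross_smul_smul`.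
-/

-- the summit and its single problem share the name `NavierStokesRegularity` (D-0017 nested layout)
set_option linter.dupNamespace false

noncomputable section

open MeasureTheory Set Function Filter TopologicalSpace Metric
open scoped Topology NNReal ENNReal InnerProductSpace RealInnerProductSpace Laplacian

namespace Summit.NavierStokesRegularity.NavierStokesRegularity.Theorems.ScenarioCensus.ThinTop

open Literature.Analysis Literature.Analysis.FluidPDE
open Summit.NavierStokesRegularity.NavierStokesRegularity.Theorems
open Summit.NavierStokesRegularity.NavierStokesRegularity.Theorems.ScenarioCensus.LiouvilleSocket
open Summit.NavierStokesRegularity.NavierStokesRegularity.Theorems.ScenarioCensus.SharpTop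

/-! ## §8 LINE 27's SCALE-INVARIANT-VOLUME ROW `F1vol` IS THE `r = 1` MEMBER OF THE VOLUME AXIS: `Row_F1ps → Row_F1vol` (Tonelli).
The definitions `volIntegrand`, `Row_F1vol` and the lemma `volIntegrand_mono` are LINE 27/28 verbatim. -/

/-- The super-`κ` space–time set on `[t₀, T) × ℝ³` (`t₀ ≥ 0`) is measurable. -/
theorem measurableSet_volTop {ν T : ℝ} {u : ℝ → E3 → E3} {p : ℝ → E3 → ℝ}
    (hsol : IsClassicalNSSolutionOn (Ico 0 T) ν 0 u p) (κ : ℝ) {t₀ : ℝ} (ht₀ : 0 ≤ t₀) :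
    MeasurableSet {z : ℝ × E3 | z.1 ∈ Ico t₀ T ∧ κ * (ν * (T - z.1)⁻¹) < ‖u z.1 z.2‖ ^ 2} := by
  classical
  set slab : Set (ℝ × E3) := Ico 0 T ×ˢ (univ : Set E3) with hslab_def
  have hslab : MeasurableSet slab := measurableSet_Ico.prod MeasurableSet.univ
  have hgm : Measurable (slab.piecewise (uncurry u) (fun _ => (0 : E3))) :=
    ContinuousOn.measurable_piecewise hsol.smooth_velocity.continuousOn continuousOn_const hslab
  have hG : Measurable fun z : ℝ × E3 => ‖slab.piecewise (uncurry u) (fun _ => (0 : E3)) z‖ ^ 2 := hgm.norm.pow_const 2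
  have hL : Measurable fun z : ℝ × E3 => κ * (ν * (T - z.1)⁻¹) :=
    measurable_const.mul (measurable_const.mul ((measurable_const.sub measurable_fst).inv))
  have hslab' : MeasurableSet (Ico t₀ T ×ˢ (univ : Set E3)) := measurableSet_Ico.prod MeasurableSet.univ
  have hS : {z : ℝ × E3 | z.1 ∈ Ico t₀ T ∧ κ * (ν * (T - z.1)⁻¹) < ‖u z.1 z.2‖ ^ 2} =
      (Ico t₀ T ×ˢ (univ : Set E3)) ∩
        {z | κ * (ν * (T - z.1)⁻¹) < ‖slab.piecewise (uncurry u) (fun _ => (0 : E3)) z‖ ^ 2} := by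
    ext z
    simp only [mem_setOf_eq, mem_inter_iff, mem_prod, mem_univ, and_true]
    constructor
    · rintro ⟨hz, hlt⟩
      have hz' : z ∈ slab := by
        simp only [hslab_def, mem_prod, mem_univ, and_true]; exact ⟨ht₀.trans hz.1, hz.2⟩
      refine ⟨hz, ?_⟩
      rw [piecewise_eq_of_mem _ _ _ hz']
      exact hlt
    · rintro ⟨hz, hlt⟩
      have hz' : z ∈ slab := by
        simp only [hslab_def, mem_prod, mem_univ, and_true]; exact ⟨ht₀.trans hz.1, hz.2⟩
      refine ⟨hz, ?_⟩
      rw [piecewise_eq_of_mem _ _ _ hz'] at hlt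
      exact hlt
  rw [hS]
  exact hslab'.inter (measurableSet_lt hL hG)

/-- The scale-invariant volume element is measurable (`t₀ ≥ 0`). -/
theorem measurable_volIntegrand {ν T : ℝ} {u : ℝ → E3 → E3} {p : ℝ → E3 → ℝ}
    (hsol : IsClassicalNSSolutionOn (Ico 0 T) ν 0 u p) (κ : ℝ) {t₀ : ℝ} (ht₀ : 0 ≤ t₀) :
    Measurable (volIntegrand T ν κ t₀ u) := by
  unfold volIntegrand
  refine Measurable.indicator ?_ (measurableSet_volTop hsol κ ht₀)
  exact ENNReal.measurable_ofReal.comp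
    ((Real.continuous_sqrt.measurable.comp (measurable_const.sub measurable_fst)).mul
      ((measurable_const.sub measurable_fst).pow_const 3).inv)

/-- Each time slice of a classical solution is continuous, so the fast slice is measurable (`t ∈ [0, T)`). -/
theorem measurableSet_fastSlice {ν T : ℝ} {u : ℝ → E3 → E3} {p : ℝ → E3 → ℝ}
    (hsol : IsClassicalNSSolutionOn (Ico 0 T) ν 0 u p) (κ : ℝ) {t : ℝ} (ht : t ∈ Ico 0 T) :
    MeasurableSet (fastSlice T ν κ u t) := by
  have hcont : Continuous (u t) := by
    have h1 : ContinuousOn (uncurry u) (Ico 0 T ×ˢ (univ : Set E3)) := hsol.smooth_velocity.continuousOn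
    have h2 : Continuous fun x : E3 => ((t, x) : ℝ × E3) := continuous_const.prodMk continuous_id
    have h3 : ∀ x : E3, ((t, x) : ℝ × E3) ∈ Ico 0 T ×ˢ (univ : Set E3) := fun x => ⟨ht, mem_univ _⟩
    exact h1.comp_continuous h2 h3
  exact measurableSet_lt measurable_const hcont.measurable.norm

/-- **Tonelli for the scale-invariant volume** (`κ ≥ 0`, `t₀ ≥ 0`): `∬ volIntegrand = ∫_{[t₀,T)} vol(F^κ_t) √(T−t) (T−t)⁻³ dt`. -/
theorem lintegral_volIntegrand_eq {ν T κ t₀ : ℝ} {u : ℝ → E3 → E3} {p : ℝ → E3 → ℝ} (hν : 0 < ν)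
    (hsol : IsClassicalNSSolutionOn (Ico 0 T) ν 0 u p) (hκ : 0 ≤ κ) (ht₀ : 0 ≤ t₀) :
    ∫⁻ z, volIntegrand T ν κ t₀ u z =
      ∫⁻ t in Ico t₀ T, volume (fastSlice T ν κ u t) * ENNReal.ofReal (Real.sqrt (T - t) * ((T - t) ^ 3)⁻¹) := by
  rw [show (volume : Measure (ℝ × E3)) = (volume : Measure ℝ).prod (volume : Measure E3) from rfl,
    lintegral_prod _ (measurable_volIntegrand hsol κ ht₀).aemeasurable, ← lintegral_indicator measurableSet_Ico]
  refine lintegral_congr fun t => ?_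
  by_cases ht : t ∈ Ico t₀ T
  · have ht' : t ∈ Ico 0 T := ⟨ht₀.trans ht.1, ht.2⟩
    rw [indicator_of_mem ht]
    have hpt : ∀ x : E3, volIntegrand T ν κ t₀ u (t, x) =
        (fastSlice T ν κ u t).indicator (fun _ => ENNReal.ofReal (Real.sqrt (T - t) * ((T - t) ^ 3)⁻¹)) x := by
      intro x
      unfold volIntegrand
      by_cases hx : x ∈ fastSlice T ν κ u t
      · have hz : ((t, x) : ℝ × E3) ∈ {z : ℝ × E3 | z.1 ∈ Ico t₀ T ∧ κ * (ν * (T - z.1)⁻¹) < ‖u z.1 z.2‖ ^ 2} :=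
          ⟨ht, (critLevel_lt_norm_iff hκ hν.le ht.2 (u t x)).1 hx⟩
        rw [indicator_of_mem hz, indicator_of_mem hx]
      · have hz : ((t, x) : ℝ × E3) ∉ {z : ℝ × E3 | z.1 ∈ Ico t₀ T ∧ κ * (ν * (T - z.1)⁻¹) < ‖u z.1 z.2‖ ^ 2} :=
          fun h => hx ((critLevel_lt_norm_iff hκ hν.le ht.2 (u t x)).2 h.2)
        rw [indicator_of_notMem hz, indicator_of_notMem hx]
    simp_rw [hpt]
    rw [lintegral_indicator_const (measurableSet_fastSlice hsol κ ht'), mul_comm]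
  · rw [indicator_of_notMem ht]
    have hpt : ∀ x : E3, volIntegrand T ν κ t₀ u (t, x) = 0 := by
      intro x
      unfold volIntegrand
      exact indicator_of_notMem (fun h => ht h.1) _
    simp_rw [hpt]
    exact lintegral_zero

/-- The `r = 1` integrand of row F1ps is `ν^{−3/2}` times the Tonelli slice of the scale-invariant volume element (`t < T`). -/
theorem fastFraction_div_eq {T ν κ t : ℝ} (hν : 0 < ν) (ht : t < T) (u : ℝ → E3 → E3) :
    fastFraction T ν κ u t ^ (1 : ℝ) / ENNReal.ofReal (T - t) =
      (ENNReal.ofReal (Real.sqrt ν ^ 3))⁻¹ *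
        (volume (fastSlice T ν κ u t) * ENNReal.ofReal (Real.sqrt (T - t) * ((T - t) ^ 3)⁻¹)) := by
  have hσ : 0 < T - t := sub_pos.2 ht
  have hs : 0 < Real.sqrt (T - t) := Real.sqrt_pos.2 hσ
  have hd : 0 < Real.sqrt (T - t) * ((T - t) ^ 3)⁻¹ := mul_pos hs (inv_pos.2 (pow_pos hσ 3))
  have hc : 0 < Real.sqrt ν ^ 3 := pow_pos (Real.sqrt_pos.2 hν) 3
  have ha : 0 < Real.sqrt (ν * (T - t)) ^ 3 := pow_pos (Real.sqrt_pos.2 (mul_pos hν hσ)) 3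
  -- the real identity `√(ν(T−t))³ · (T − t) = √ν³ / (√(T−t) (T−t)⁻³)`
  have hreal : Real.sqrt (ν * (T - t)) ^ 3 * (T - t) = Real.sqrt ν ^ 3 / (Real.sqrt (T - t) * ((T - t) ^ 3)⁻¹) := by
    rw [eq_div_iff hd.ne', Real.sqrt_mul hν.le]
    have h2 : Real.sqrt (T - t) ^ 2 = T - t := Real.sq_sqrt hσ.le
    have h3 : (T - t) ^ 3 ≠ 0 := (pow_pos hσ 3).ne'
    field_simp
    nlinarith [h2, hs]
  rw [ENNReal.rpow_one, fastFraction, parabVol, div_eq_mul_inv, div_eq_mul_inv, mul_assoc,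
    ← ENNReal.mul_inv (Or.inl (ENNReal.ofReal_pos.2 ha).ne') (Or.inl ENNReal.ofReal_ne_top),
    ← ENNReal.ofReal_mul ha.le, hreal, ENNReal.ofReal_div_of_pos hd,
    ENNReal.inv_div (Or.inl ENNReal.ofReal_ne_top) (Or.inl (ENNReal.ofReal_pos.2 hd).ne'), div_eq_mul_inv]
  ring

/-- **`Row_F1ps → Row_F1vol`**: LINE 27's scale-invariant-volume row is the `r = 1` member of the volume axis (its
hypothesis, read through Tonelli, is `∫ Φ_κ dt/(T − t) < ∞` up to the factor `ν^{3/2}`).  Hence `Row_F1vol` holds again,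
now as a COROLLARY of the thin-top row. -/
theorem rowF1vol_of_rowF1ps (h : Row_F1ps) : Row_F1vol := by
  intro ν T hν hT u p hsol hLH hdec hTI hyp
  obtain ⟨κ, t₀, hκ, ht₀, ht₀T, hfin⟩ := hyp
  -- pass to `κ₊ = max κ 0`
  have hκ' : max κ 0 < 1 := max_lt hκ zero_lt_one
  have hfin' : ∫⁻ z, volIntegrand T ν (max κ 0) t₀ u z < ⊤ :=
    lt_of_le_of_lt (lintegral_mono fun z => volIntegrand_mono (le_max_left κ 0) hν.le t₀ u z) hfin
  refine h ν T hν hT u p hsol hLH hdec hTI ⟨max κ 0, 1, t₀, hκ', one_pos, ht₀T, ?_⟩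
  rw [lintegral_volIntegrand_eq hν hsol (le_max_right κ 0) ht₀] at hfin'
  have hC : (ENNReal.ofReal (Real.sqrt ν ^ 3))⁻¹ ≠ ⊤ :=
    ENNReal.inv_ne_top.2 (ENNReal.ofReal_pos.2 (pow_pos (Real.sqrt_pos.2 hν) 3)).ne'
  calc ∫⁻ t in Ioo t₀ T, fastFraction T ν (max κ 0) u t ^ (1 : ℝ) / ENNReal.ofReal (T - t)
      = ∫⁻ t in Ioo t₀ T, (ENNReal.ofReal (Real.sqrt ν ^ 3))⁻¹ *
          (volume (fastSlice T ν (max κ 0) u t) * ENNReal.ofReal (Real.sqrt (T - t) * ((T - t) ^ 3)⁻¹)) := by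
        refine setLIntegral_congr_fun measurableSet_Ioo (fun t ht => ?_)
        exact fastFraction_div_eq hν ht.2 u
    _ = (ENNReal.ofReal (Real.sqrt ν ^ 3))⁻¹ * ∫⁻ t in Ioo t₀ T,
          volume (fastSlice T ν (max κ 0) u t) * ENNReal.ofReal (Real.sqrt (T - t) * ((T - t) ^ 3)⁻¹) := by
        rw [lintegral_const_mul' _ _ hC]
    _ ≤ (ENNReal.ofReal (Real.sqrt ν ^ 3))⁻¹ * ∫⁻ t in Ico t₀ T,
          volume (fastSlice T ν (max κ 0) u t) * ENNReal.ofReal (Real.sqrt (T - t) * ((T - t) ^ 3)⁻¹) :=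
        mul_le_mul_right (lintegral_mono_set Ioo_subset_Ico_self) _
    _ < ⊤ := ENNReal.mul_lt_top hC.lt_top hfin'

/-- The chain of rows of the volume axis: `F1th ⇒ F1ps ⇒ F1vol` and `F1th ⇒ F1vo` (all PROVED). -/
theorem volumeAxis_chain : (Row_F1th → Row_F1ps) ∧ (Row_F1ps → Row_F1vol) ∧ (Row_F1th → Row_F1vo) :=
  ⟨rowF1ps_of_rowF1th, rowF1vol_of_rowF1ps, rowF1vo_of_rowF1th⟩

/-! ## §9 THE WEAK-`L³` READING OF THE VOLUME AXIS.  `Λ♯_κ(t)³ · (ν(T − t))^{3/2} = (√κ ν)³` is CONSTANT IN TIME, so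
`Φ_κ(t) = (√κ ν)⁻³ · [λ³ vol{|u(t)| > λ}]_{λ = Λ♯_κ(t)}`: the volume fraction is the weak-`L³` profile `λ ↦ λ³ vol{|u(t)| > λ}`
of the slice READ AT THE SELF-SIMILAR LEVEL.  Row F1wk «Type I + the weak-`L³` profile of the slice ABOVE the level
`√(κν/(T − t))` evanesces» follows from F1vo; its floor says that at a Type-I blow-up the `L^{3,∞}` quasi-norm of `u(t)`
carried by near-self-similar speeds does NOT evanesce, at EVERY fraction `κ < 1` (the classical small-`L^{3,∞}` floor only
says the full quasi-norm stays `≥ ε₀`, at unspecified levels). -/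

/-- The WEAK-`L³` PROFILE OF A FIELD ABOVE LEVEL `l₀`: `sup_{λ ≥ l₀} λ³ · vol{x : λ < |v(x)|} ∈ [0, ∞]` (for `l₀ ≤ 0` this is
the cube of the `L^{3,∞}` quasi-norm of `v`). -/
def weakCubeAbove (l₀ : ℝ) (v : E3 → E3) : ℝ≥0∞ :=
  ⨆ (l : ℝ) (_ : l₀ ≤ l), ENNReal.ofReal (l ^ 3) * volume {x | l < ‖v x‖}

/-- The truncated profile is ANTITONE in the truncation level. -/
theorem weakCubeAbove_anti {l₀ l₁ : ℝ} (h : l₀ ≤ l₁) (v : E3 → E3) : weakCubeAbove l₁ v ≤ weakCubeAbove l₀ v := by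
  unfold weakCubeAbove
  exact iSup₂_le fun l hl =>
    le_iSup₂ (f := fun (l : ℝ) (_ : l₀ ≤ l) => ENNReal.ofReal (l ^ 3) * volume {x | l < ‖v x‖}) l (h.trans hl)

/-- The fast slice enters the profile at the critical level. -/
theorem volume_fastSlice_mul_le_weakCubeAbove (T ν κ t : ℝ) (u : ℝ → E3 → E3) :
    volume (fastSlice T ν κ u t) * ENNReal.ofReal (critLevel T ν κ t ^ 3) ≤
      weakCubeAbove (critLevel T ν κ t) (u t) := by
  rw [mul_comm]
  unfold weakCubeAbove fastSlice
  exact le_iSup₂ (f := fun (l : ℝ) (_ : critLevel T ν κ t ≤ l) => ENNReal.ofReal (l ^ 3) * volume {x | l < ‖u t x‖})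
    (critLevel T ν κ t) le_rfl

/-- **The level identity** `Λ♯_κ(t)³ · (ν(T − t))^{3/2} = (√κ ν)³` (constant in time; `κ ≥ 0`, `ν > 0`, `t < T`). -/
theorem critLevel_pow_mul_parabVol {T ν κ t : ℝ} (hκ : 0 ≤ κ) (hν : 0 < ν) (ht : t < T) :
    ENNReal.ofReal (critLevel T ν κ t ^ 3) * parabVol T ν t = ENNReal.ofReal ((Real.sqrt κ * ν) ^ 3) := by
  have hσ : 0 < T - t := sub_pos.2 ht
  have ha : 0 ≤ κ * (ν * (T - t)⁻¹) := mul_nonneg hκ (mul_nonneg hν.le (inv_nonneg.2 hσ.le))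
  have e : Real.sqrt (κ * (ν * (T - t)⁻¹) * (ν * (T - t))) = Real.sqrt κ * ν := by
    rw [show κ * (ν * (T - t)⁻¹) * (ν * (T - t)) = κ * ν ^ 2 by field_simp, Real.sqrt_mul hκ, Real.sqrt_sq hν.le]
  unfold critLevel parabVol
  rw [← ENNReal.ofReal_mul (pow_nonneg (Real.sqrt_nonneg _) 3), ← mul_pow, ← Real.sqrt_mul ha, e]

/-- **`Φ_κ(t) ≤ (√κ ν)⁻³ · (weak-L³ profile above the critical level)`** (`0 < κ`, `t < T`). -/
theorem fastFraction_le_weakCubeAbove_div {T ν κ t : ℝ} (hκ : 0 < κ) (hν : 0 < ν) (ht : t < T) (u : ℝ → E3 → E3) :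
    fastFraction T ν κ u t ≤ weakCubeAbove (critLevel T ν κ t) (u t) / ENNReal.ofReal ((Real.sqrt κ * ν) ^ 3) := by
  have hcl : 0 < critLevel T ν κ t := by
    unfold critLevel
    exact Real.sqrt_pos.2 (mul_pos hκ (mul_pos hν (inv_pos.2 (sub_pos.2 ht))))
  have hc : ENNReal.ofReal (critLevel T ν κ t ^ 3) ≠ 0 := (ENNReal.ofReal_pos.2 (pow_pos hcl 3)).ne'
  unfold fastFraction
  rw [← ENNReal.mul_div_mul_right (volume (fastSlice T ν κ u t)) (parabVol T ν t) hc ENNReal.ofReal_ne_top,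
    mul_comm (parabVol T ν t), critLevel_pow_mul_parabVol hκ.le hν ht]
  exact ENNReal.div_le_div (volume_fastSlice_mul_le_weakCubeAbove T ν κ t u) le_rfl

/-- **Criterion row F1wk «EVANESCENT WEAK-L³ PROFILE ABOVE THE SELF-SIMILAR LEVEL»**: the frame of `Row_F1` plus — for
some `κ < 1`, `sup_{λ ≥ √(κν/(T − t))} λ³ vol{|u(t)| > λ} → 0` as `t ↑ T` — ⇒ smooth extension.  (A criterion in the
classical `L^{3,∞}` language: ESŠ for `L^{3,∞}` is OPEN — self-similar-size profiles have bounded weak-`L³` norm — and under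
Type I, evanescence of the part of the weak-`L³` profile above ONE near-self-similar level suffices.)
PROVED (`rowF1wk_holds`, from row F1vo). -/
def Row_F1wk : Prop :=
  ∀ (ν T : ℝ), 0 < ν → 0 < T → ∀ (u : ℝ → E3 → E3) (p : ℝ → E3 → ℝ),
    IsClassicalNSSolutionOn (Ico 0 T) ν 0 u p → IsLerayHopfOn T ν 0 (u 0) u →
    HasRapidSpatialDecay (u 0) → IsTypeIBlowup u T →
    (∃ κ : ℝ, κ < 1 ∧ Tendsto (fun t => weakCubeAbove (critLevel T ν κ t) (u t)) (𝓝[<] T) (𝓝 0)) →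
    HasSmoothExtensionPast ν 0 u T

/-- **THE WEAK-L³ PROFILE CARRIED BY NEAR-SELF-SIMILAR SPEEDS DOES NOT EVANESCE** (floor of F1wk, maximal frame): at a
maximal Type-I Clay blow-up, for EVERY `κ < 1`, `sup_{λ ≥ √(κν/(T − t))} λ³ vol{|u(t)| > λ} ↛ 0` as `t ↑ T`.  PROVED. -/
def PersistentWeakCube : Prop :=
  ∀ (ν T : ℝ), 0 < ν → 0 < T → ∀ (u : ℝ → E3 → E3) (p : ℝ → E3 → ℝ),
    IsMaximalSmoothSolution ν 0 u p T → IsLerayHopfOn T ν 0 (u 0) u →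
    HasRapidSpatialDecay (u 0) → IsTypeIBlowup u T →
    ∀ κ : ℝ, κ < 1 → ¬ Tendsto (fun t => weakCubeAbove (critLevel T ν κ t) (u t)) (𝓝[<] T) (𝓝 0)

/-- **Row F1wk follows from row F1vo** (pass to `κ′ = max κ ½ ∈ (0, 1)`: the truncated profile only decreases, and
`Φ_{κ′} ≤ (√κ′ ν)⁻³ ×` it). -/
theorem rowF1wk_of_rowF1vo (h : Row_F1vo) : Row_F1wk := by
  intro ν T hν hT u p hsol hLH hdec hTI hyp
  obtain ⟨κ, hκ, hW⟩ := hyp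
  have hκ'1 : max κ (1 / 2) < 1 := max_lt hκ (by norm_num)
  have hκ'0 : 0 < max κ (1 / 2) := lt_of_lt_of_le (by norm_num) (le_max_right _ _)
  refine h ν T hν hT u p hsol hLH hdec hTI ⟨max κ (1 / 2), hκ'1, ?_⟩
  have hD : ENNReal.ofReal ((Real.sqrt (max κ (1 / 2)) * ν) ^ 3) ≠ 0 :=
    (ENNReal.ofReal_pos.2 (pow_pos (mul_pos (Real.sqrt_pos.2 hκ'0) hν) 3)).ne'
  have hW' : Tendsto (fun t => weakCubeAbove (critLevel T ν (max κ (1 / 2)) t) (u t)) (𝓝[<] T) (𝓝 0) := by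
    refine tendsto_of_tendsto_of_tendsto_of_le_of_le' tendsto_const_nhds hW (Eventually.of_forall fun _ => bot_le) ?_
    filter_upwards [self_mem_nhdsWithin] with t ht
    exact weakCubeAbove_anti (critLevel_mono (le_max_left κ _) hν.le ht) (u t)
  have hlim : Tendsto (fun t => weakCubeAbove (critLevel T ν (max κ (1 / 2)) t) (u t) /
      ENNReal.ofReal ((Real.sqrt (max κ (1 / 2)) * ν) ^ 3)) (𝓝[<] T) (𝓝 0) := by
    have h1 := ENNReal.Tendsto.div_const hW' (Or.inr hD)
    rw [ENNReal.zero_div] at h1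
    exact h1
  refine tendsto_of_tendsto_of_tendsto_of_le_of_le' tendsto_const_nhds hlim (Eventually.of_forall fun _ => bot_le) ?_
  filter_upwards [self_mem_nhdsWithin] with t ht
  exact fastFraction_le_weakCubeAbove_div hκ'0 hν ht u

/-- **Row F1wk holds** (weak-`L³` reading). -/
theorem rowF1wk_holds : Row_F1wk := rowF1wk_of_rowF1vo rowF1vo_holds

/-- **The floor of F1wk holds.** -/
theorem persistentWeakCube_holds : PersistentWeakCube := by
  intro ν T hν hT u p hmax hLH hdec hTI κ hκ hlim
  exact hmax.2 (rowF1wk_holds ν T hν hT u p hmax.1 hLH hdec hTI ⟨κ, hκ, hlim⟩)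

end Summit.NavierStokesRegularity.NavierStokesRegularity.Theorems.ScenarioCensus.ThinTop

namespace Summit.NavierStokesRegularity.NavierStokesRegularity.Theorems.ScenarioCensus

/-! ## Census KEYS (ns `…Theorems.ScenarioCensus`): the VOLUME-AXIS members of row F1 (LINE 29 «thin-top») — TREE-decided F1th / F1vo / F1ps / F1wk and floors RFS / PFS / DTH / PWC -/

/-- **Cell F1th «THIN TOP»** (row F1 frame VERBATIM + for some `κ < 1` and EVERY `δ > 0` the `δ`-fat times of the `κ`-fast slice `{|u(t)|² > κν/(T−t)}` are NULL IN EVERY SCALE WINDOW at `T` ⇒ smooth extension past `T`): `:= ThinTop.Row_F1th`. DECIDED. -/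
def Row_F1th : Prop := ThinTop.Row_F1th
/-- F1th is EXCLUDED (decided in the tree): `ThinTop.rowF1th_holds`. -/
theorem row_F1th_excluded : Row_F1th := ThinTop.rowF1th_holds

/-- **Cell F1vo «EVANESCENT TOP»** (row F1 frame + for some `κ < 1` the volume fraction `Φ_κ(t) → 0` as `t ↑ T`): `:= ThinTop.Row_F1vo`. DECIDED. -/
def Row_F1vo : Prop := ThinTop.Row_F1vo
/-- F1vo is EXCLUDED (decided in the tree): `ThinTop.rowF1vo_holds`. -/
theorem row_F1vo_excluded : Row_F1vo := ThinTop.rowF1vo_holds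

/-- **Cell F1ps «`r`-THIN TOP»** (row F1 frame + for some `κ < 1`, `r > 0`, `t₀ < T`: `∫_{t₀}^T Φ_κ^r dt/(T−t) < ∞`): `:= ThinTop.Row_F1ps`. DECIDED. -/
def Row_F1ps : Prop := ThinTop.Row_F1ps
/-- F1ps is EXCLUDED (decided in the tree): `ThinTop.rowF1ps_holds`. -/
theorem row_F1ps_excluded : Row_F1ps := ThinTop.rowF1ps_holds

/-- **Cell F1wk «WEAK-L³ READING»** (row F1 frame + for some `κ < 1`: `sup_{λ ≥ √(κν/(T−t))} λ³ vol{|u(t)| > λ} → 0`): `:= ThinTop.Row_F1wk`. DECIDED. -/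
def Row_F1wk : Prop := ThinTop.Row_F1wk
/-- F1wk is EXCLUDED (decided in the tree): `ThinTop.rowF1wk_holds`. -/
theorem row_F1wk_excluded : Row_F1wk := ThinTop.rowF1wk_holds

/-- **Floor RFS — RECURRENT FAT SLICES**: `ThinTop.recurrentFatSlices_holds`. -/
theorem row_F1_recurrentFatSlices : ThinTop.RecurrentFatSlices := ThinTop.recurrentFatSlices_holds
/-- **Floor PFS — PERSISTENT FAST SLICE**: `ThinTop.persistentFastSlice_holds`. -/
theorem row_F1_persistentFastSlice : ThinTop.PersistentFastSlice := ThinTop.persistentFastSlice_holds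
/-- **Floor DTH — DIVERGENT THINNESS**: `ThinTop.divergentThinness_holds`. -/
theorem row_F1_divergentThinness : ThinTop.DivergentThinness := ThinTop.divergentThinness_holds
/-- **Floor PWC — PERSISTENT WEAK CUBE**: `ThinTop.persistentWeakCube_holds`. -/
theorem row_F1_persistentWeakCube : ThinTop.PersistentWeakCube := ThinTop.persistentWeakCube_holds
/-- Lattice edges at key level (hypothesis classes): F1th ⇒ F1vo, F1th ⇒ F1ps, F1ps ⇒ F1vol, F1vo ⇒ F1wk (`ThinTop.rowF1vo_of_rowF1th` / `rowF1ps_of_rowF1th` /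
`rowF1vol_of_rowF1ps` / `rowF1wk_of_rowF1vo`). -/
theorem rowF1vo_of_rowF1th : Row_F1th → Row_F1vo := ThinTop.rowF1vo_of_rowF1th
/-- See `rowF1vo_of_rowF1th`. -/
theorem rowF1ps_of_rowF1th : Row_F1th → Row_F1ps := ThinTop.rowF1ps_of_rowF1th
/-- See `rowF1vo_of_rowF1th`. -/
theorem rowF1vol_of_rowF1ps : Row_F1ps → Row_F1vol := ThinTop.rowF1vol_of_rowF1ps
/-- See `rowF1vo_of_rowF1th`. -/
theorem rowF1wk_of_rowF1vo : Row_F1vo → Row_F1wk := ThinTop.rowF1wk_of_rowF1vo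

end Summit.NavierStokesRegularity.NavierStokesRegularity.Theorems.ScenarioCensus

end
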